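import Summits.QuantumFields.YangMills.Theorems.UnitScaleTiltProp7PinnedRegaugeChartDivergenceHRK
import Summits.QuantumFields.YangMills.Theorems.UnitScaleTiltProp7CovariantPlaquetteExpansion
import HarnessLib

/-!
# Prop 7 — the door's linearised-curvature energy `K_W` (plaquette form) versus the `B9Eq39Adjoint` curl energy (S4′, part 1)

Route-R E′, path (α′), junction S4′ of `stmt-QuantumFields-19200` (crux `MinimiserStabilityRegPr`), cell ym3-torus, width seat px15.

WHY.  The (α′) knit's door (✓ `Prop7SliceOfCorrectorRows`, ✓ `Prop7PV3EOfCorrectorRows`) measures curvature by the PLAQUETTE form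
`K_W(Z) = Σ_p ‖Z(b₁) + W(b₁)Z(b₂)W(b₁)* − g_p Z(b₃) g_p* − U(∂p) Z(b₄) U(∂p)*‖²` (`g_p = W(b₁)W(b₂)W(b₃)⁻¹`, `b₁..b₄` the boundary bonds of `p`),
while the Weitzenböck bricks (✓ `Prop7CovIterLambdaHLambdaBridge.sum_normSq_covGrad_le_curl_divB`, ✓p659458, ✓p660134) measure it by the `B9Eq39Adjoint` curl
`(D_W Z)(p_{μν}(x)) = D_μZ_ν − D_νZ_μ`.  The two differ by a conjugation with the plaquette holonomy: `K_p(Z) − curl_p(Z) = −(Ad_{U(∂p)} − 1)(W(b₄)Z(b₃)W(b₄)* + Z(b₄))`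
(because `g_p = U(∂p)·W(b₄)`), so `‖K_p − curl_p‖ ≤ 2‖U(∂p) − 1‖·(‖Z(b₃)‖ + ‖Z(b₄)‖)`.

WHAT IS PROVED (def-free; any `P`, level `i`, `SU(N)`).
* §1 `curl_torus_eq` (the B9 curl on the torus in bond letters), `plaqTerm_sub_curl_eq` (the identity above), ★ `norm_curl_le_plaqTerm_add`
  (`‖curl_p(Z)‖ ≤ ‖K_p(Z)‖ + 2a(‖Z(b₃)‖ + ‖Z(b₄)‖)` under `dist1(W(∂p)) ≤ a`).
* §2 `sum_ite_eq_sum_plaq` (re-indexing `Σ_x Σ_{μ<ν} = Σ_p`), ★★★ `curlHS_le_plaqK` (THE COMPARISON):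
  `CURL_HS(i·D) ≤ N·(2·K_W(i·D) + 32·d·a²·Σ_b‖D_b‖²)` — the B9 curl energy (HS, as consumed by the Weitzenböck bricks) is at most twice the door's `K_W`
  (times `N` for HS ≤ N·op) plus a curvature term `a² ≍ e²ℓ⁻⁴` times the bond mass.
HONEST SCOPE.  Algebra and bookkeeping; no analysis.  Constants ours.

References: T. Bałaban, CMP 102 (1985) 277–309 [Balaban1985Variational] ((47)–(48) pp.285–286, (135) p.298); CMP 99 (1985) 389–434 [Balaban1985BackgroundPropagators]
((3.4) p.391); CMP 98 (1985) 17–51 [Balaban1985Averaging] ((9) p.19).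
-/

set_option autoImplicit false

noncomputable section

open scoped BigOperators Matrix.Norms.L2Operator Matrix
open NormedSpace

namespace Summit.QuantumFields.YangMills.Theorems.Prop7PlaquetteCurlComparison

open Literature.MathematicalPhysics.QuantumFieldTheory.Balaban1983to89
open Finset B1RG242Torus
open B9Eq39Adjoint (R R_def covD curl)
open B10StarCount (sum_pbond)
open B10Eq27TorusAxialLog (unitsField toUField)
open B9TorusCalculus (torusT torusT_apply)
open Summit.QuantumFields.YangMills.Theorems.Prop7HolRatioPerStep (coe_mul_star_self coe_star_mul_self)
open Summit.QuantumFields.YangMills.Theorems.Prop7CovIterLambdaBound (norm_conj_su_le)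
open Summit.QuantumFields.YangMills.Theorems.Prop7CovariantCoercivity (norm_conj_sub_self_le' sum_norm_sq_le_mul_opNorm_sq)
open Summit.QuantumFields.YangMills.Theorems.Prop7PinnedRegaugeChartDivergence (coe_inv_eq_star)
open Summit.QuantumFields.YangMills.Theorems.Prop7PinnedRegaugeChartDivergenceTorus (coe_unitsField_toUField)
open Summit.QuantumFields.YangMills.Theorems.Prop7PinnedRegaugeChartDivergenceHRK (sum_plaq_le_sum_site_dir sum_site_dir_dir_shift_eq)

variable {P : Params} {N : ℕ} [NeZero N] {i : ℕ}

/-! ## §1 The plaquette term against the curl, pointwise -/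

omit [NeZero N] in
/-- The `B9Eq39Adjoint` curl on the torus in bond letters: at `p_{μν}(x)`,
`curl = Z(x,μ) + W(x,μ)Z(x+e_μ,ν)W(x,μ)* − W(x,ν)Z(x+e_ν,μ)W(x,ν)* − Z(x,ν)`. [cite: Balaban1985BackgroundPropagators, (3.4) p.391] -/
theorem curl_torus_eq (W : GaugeField P i (Matrix.specialUnitaryGroup (Fin N) ℂ)) (Z : PBond P i → Matrix (Fin N) (Fin N) ℂ)
    (μ ν : Fin P.d) (x : Site P i) :
    curl (torusT P i) (fun κ z => unitsField (toUField W) ⟨z, κ⟩) (fun κ z => Z ⟨z, κ⟩) μ ν x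
      = Z ⟨x, μ⟩ + (W ⟨x, μ⟩ : Matrix (Fin N) (Fin N) ℂ) * Z ⟨x.shift μ, ν⟩ * star (W ⟨x, μ⟩ : Matrix (Fin N) (Fin N) ℂ)
        - (W ⟨x, ν⟩ : Matrix (Fin N) (Fin N) ℂ) * Z ⟨x.shift ν, μ⟩ * star (W ⟨x, ν⟩ : Matrix (Fin N) (Fin N) ℂ) - Z ⟨x, ν⟩ := by
  have hUW := coe_unitsField_toUField W
  simp only [curl, covD, R_def, coe_inv_eq_star _ (fun κ z => W ⟨z, κ⟩) hUW, hUW, torusT_apply]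
  abel

/-- **The door's plaquette term minus the curl is a holonomy commutator**:
`K_p(Z) − curl_p(Z) = −((U(∂p)·X·U(∂p)* − X))` with `X = W(b₄)Z(b₃)W(b₄)* + Z(b₄)` (because `W(b₁)W(b₂)W(b₃)⁻¹ = U(∂p)·W(b₄)`).
[cite: Balaban1985Averaging, (9) p.19] [cite: Balaban1985Variational, (47)-(48) pp.285-286] -/
theorem plaqTerm_sub_curl_eq (W : GaugeField P i (Matrix.specialUnitaryGroup (Fin N) ℂ)) (Z : PBond P i → Matrix (Fin N) (Fin N) ℂ) (p : Plaq P i) :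
    ((Z ⟨p.src, p.μ⟩
          + ((W ⟨p.src, p.μ⟩ : Matrix (Fin N) (Fin N) ℂ) * Z ⟨p.src.shift p.μ, p.ν⟩ * star (W ⟨p.src, p.μ⟩ : Matrix (Fin N) (Fin N) ℂ))
          - (((W ⟨p.src, p.μ⟩ * W ⟨p.src.shift p.μ, p.ν⟩ * (W ⟨p.src.shift p.ν, p.μ⟩)⁻¹ : Matrix.specialUnitaryGroup (Fin N) ℂ) : Matrix (Fin N) (Fin N) ℂ)
              * Z ⟨p.src.shift p.ν, p.μ⟩
              * star ((W ⟨p.src, p.μ⟩ * W ⟨p.src.shift p.μ, p.ν⟩ * (W ⟨p.src.shift p.ν, p.μ⟩)⁻¹ : Matrix.specialUnitaryGroup (Fin N) ℂ) : Matrix (Fin N) (Fin N) ℂ))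
          - (((GaugeField.plaqHol W p : Matrix.specialUnitaryGroup (Fin N) ℂ) : Matrix (Fin N) (Fin N) ℂ) * Z ⟨p.src, p.ν⟩
              * star ((GaugeField.plaqHol W p : Matrix.specialUnitaryGroup (Fin N) ℂ) : Matrix (Fin N) (Fin N) ℂ)))
        - curl (torusT P i) (fun κ z => unitsField (toUField W) ⟨z, κ⟩) (fun κ z => Z ⟨z, κ⟩) p.μ p.ν p.src)
      = -((((GaugeField.plaqHol W p : Matrix.specialUnitaryGroup (Fin N) ℂ) : Matrix (Fin N) (Fin N) ℂ)
            * ((W ⟨p.src, p.ν⟩ : Matrix (Fin N) (Fin N) ℂ) * Z ⟨p.src.shift p.ν, p.μ⟩ * star (W ⟨p.src, p.ν⟩ : Matrix (Fin N) (Fin N) ℂ) + Z ⟨p.src, p.ν⟩)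
            * star ((GaugeField.plaqHol W p : Matrix.specialUnitaryGroup (Fin N) ℂ) : Matrix (Fin N) (Fin N) ℂ))
          - ((W ⟨p.src, p.ν⟩ : Matrix (Fin N) (Fin N) ℂ) * Z ⟨p.src.shift p.ν, p.μ⟩ * star (W ⟨p.src, p.ν⟩ : Matrix (Fin N) (Fin N) ℂ) + Z ⟨p.src, p.ν⟩)) := by
  have hg : (W ⟨p.src, p.μ⟩ * W ⟨p.src.shift p.μ, p.ν⟩ * (W ⟨p.src.shift p.ν, p.μ⟩)⁻¹ : Matrix.specialUnitaryGroup (Fin N) ℂ)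
      = GaugeField.plaqHol W p * W ⟨p.src, p.ν⟩ := by
    rw [GaugeField.plaqHol, inv_mul_cancel_right]
  rw [curl_torus_eq, hg]
  simp only [Submonoid.coe_mul, star_mul]
  noncomm_ring

/-- ★ **The curl against the plaquette term**: under `dist1(W(∂p)) ≤ a`,
`‖curl_p(Z)‖ ≤ ‖K_p(Z)‖ + 2a·(‖Z(b₃)‖ + ‖Z(b₄)‖)`. [cite: Balaban1985Variational, (47)-(48) pp.285-286] -/
theorem norm_curl_le_plaqTerm_add (W : GaugeField P i (Matrix.specialUnitaryGroup (Fin N) ℂ)) {a : ℝ}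
    (hU : ∀ p : Plaq P i, dist1 (GaugeField.plaqHol W p) ≤ a) (Z : PBond P i → Matrix (Fin N) (Fin N) ℂ) (p : Plaq P i) :
    ‖curl (torusT P i) (fun κ z => unitsField (toUField W) ⟨z, κ⟩) (fun κ z => Z ⟨z, κ⟩) p.μ p.ν p.src‖
      ≤ ‖(Z ⟨p.src, p.μ⟩
          + ((W ⟨p.src, p.μ⟩ : Matrix (Fin N) (Fin N) ℂ) * Z ⟨p.src.shift p.μ, p.ν⟩ * star (W ⟨p.src, p.μ⟩ : Matrix (Fin N) (Fin N) ℂ))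
          - (((W ⟨p.src, p.μ⟩ * W ⟨p.src.shift p.μ, p.ν⟩ * (W ⟨p.src.shift p.ν, p.μ⟩)⁻¹ : Matrix.specialUnitaryGroup (Fin N) ℂ) : Matrix (Fin N) (Fin N) ℂ)
              * Z ⟨p.src.shift p.ν, p.μ⟩
              * star ((W ⟨p.src, p.μ⟩ * W ⟨p.src.shift p.μ, p.ν⟩ * (W ⟨p.src.shift p.ν, p.μ⟩)⁻¹ : Matrix.specialUnitaryGroup (Fin N) ℂ) : Matrix (Fin N) (Fin N) ℂ))
          - (((GaugeField.plaqHol W p : Matrix.specialUnitaryGroup (Fin N) ℂ) : Matrix (Fin N) (Fin N) ℂ) * Z ⟨p.src, p.ν⟩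
              * star ((GaugeField.plaqHol W p : Matrix.specialUnitaryGroup (Fin N) ℂ) : Matrix (Fin N) (Fin N) ℂ)))‖
        + 2 * a * (‖Z ⟨p.src.shift p.ν, p.μ⟩‖ + ‖Z ⟨p.src, p.ν⟩‖) := by
  have ha : ‖((GaugeField.plaqHol W p : Matrix.specialUnitaryGroup (Fin N) ℂ) : Matrix (Fin N) (Fin N) ℂ) - 1‖ ≤ a := hU p
  have ha0 : 0 ≤ a := (norm_nonneg _).trans ha
  have hdiff := plaqTerm_sub_curl_eq W Z p
  -- `curl = K − (K − curl)`
  have hX : ‖(W ⟨p.src, p.ν⟩ : Matrix (Fin N) (Fin N) ℂ) * Z ⟨p.src.shift p.ν, p.μ⟩ * star (W ⟨p.src, p.ν⟩ : Matrix (Fin N) (Fin N) ℂ) + Z ⟨p.src, p.ν⟩‖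
      ≤ ‖Z ⟨p.src.shift p.ν, p.μ⟩‖ + ‖Z ⟨p.src, p.ν⟩‖ :=
    (norm_add_le _ _).trans (add_le_add (norm_conj_su_le _ _) le_rfl)
  have hcomm := norm_conj_sub_self_le' (GaugeField.plaqHol W p)
    ((W ⟨p.src, p.ν⟩ : Matrix (Fin N) (Fin N) ℂ) * Z ⟨p.src.shift p.ν, p.μ⟩ * star (W ⟨p.src, p.ν⟩ : Matrix (Fin N) (Fin N) ℂ) + Z ⟨p.src, p.ν⟩)
  have hKc : ‖(Z ⟨p.src, p.μ⟩
          + ((W ⟨p.src, p.μ⟩ : Matrix (Fin N) (Fin N) ℂ) * Z ⟨p.src.shift p.μ, p.ν⟩ * star (W ⟨p.src, p.μ⟩ : Matrix (Fin N) (Fin N) ℂ))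
          - (((W ⟨p.src, p.μ⟩ * W ⟨p.src.shift p.μ, p.ν⟩ * (W ⟨p.src.shift p.ν, p.μ⟩)⁻¹ : Matrix.specialUnitaryGroup (Fin N) ℂ) : Matrix (Fin N) (Fin N) ℂ)
              * Z ⟨p.src.shift p.ν, p.μ⟩
              * star ((W ⟨p.src, p.μ⟩ * W ⟨p.src.shift p.μ, p.ν⟩ * (W ⟨p.src.shift p.ν, p.μ⟩)⁻¹ : Matrix.specialUnitaryGroup (Fin N) ℂ) : Matrix (Fin N) (Fin N) ℂ))
          - (((GaugeField.plaqHol W p : Matrix.specialUnitaryGroup (Fin N) ℂ) : Matrix (Fin N) (Fin N) ℂ) * Z ⟨p.src, p.ν⟩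
              * star ((GaugeField.plaqHol W p : Matrix.specialUnitaryGroup (Fin N) ℂ) : Matrix (Fin N) (Fin N) ℂ)))
        - curl (torusT P i) (fun κ z => unitsField (toUField W) ⟨z, κ⟩) (fun κ z => Z ⟨z, κ⟩) p.μ p.ν p.src‖
      ≤ 2 * a * (‖Z ⟨p.src.shift p.ν, p.μ⟩‖ + ‖Z ⟨p.src, p.ν⟩‖) := by
    rw [hdiff, norm_neg]
    refine hcomm.trans ?_
    have h1 : 2 * ‖((GaugeField.plaqHol W p : Matrix.specialUnitaryGroup (Fin N) ℂ) : Matrix (Fin N) (Fin N) ℂ) - 1‖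
        * ‖(W ⟨p.src, p.ν⟩ : Matrix (Fin N) (Fin N) ℂ) * Z ⟨p.src.shift p.ν, p.μ⟩ * star (W ⟨p.src, p.ν⟩ : Matrix (Fin N) (Fin N) ℂ) + Z ⟨p.src, p.ν⟩‖
        ≤ 2 * a * (‖Z ⟨p.src.shift p.ν, p.μ⟩‖ + ‖Z ⟨p.src, p.ν⟩‖) :=
      mul_le_mul (by linarith) hX (norm_nonneg _) (by positivity)
    exact h1
  have key := norm_le_insert'
    (curl (torusT P i) (fun κ z => unitsField (toUField W) ⟨z, κ⟩) (fun κ z => Z ⟨z, κ⟩) p.μ p.ν p.src)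
    (Z ⟨p.src, p.μ⟩
          + ((W ⟨p.src, p.μ⟩ : Matrix (Fin N) (Fin N) ℂ) * Z ⟨p.src.shift p.μ, p.ν⟩ * star (W ⟨p.src, p.μ⟩ : Matrix (Fin N) (Fin N) ℂ))
          - (((W ⟨p.src, p.μ⟩ * W ⟨p.src.shift p.μ, p.ν⟩ * (W ⟨p.src.shift p.ν, p.μ⟩)⁻¹ : Matrix.specialUnitaryGroup (Fin N) ℂ) : Matrix (Fin N) (Fin N) ℂ)
              * Z ⟨p.src.shift p.ν, p.μ⟩
              * star ((W ⟨p.src, p.μ⟩ * W ⟨p.src.shift p.μ, p.ν⟩ * (W ⟨p.src.shift p.ν, p.μ⟩)⁻¹ : Matrix.specialUnitaryGroup (Fin N) ℂ) : Matrix (Fin N) (Fin N) ℂ))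
          - (((GaugeField.plaqHol W p : Matrix.specialUnitaryGroup (Fin N) ℂ) : Matrix (Fin N) (Fin N) ℂ) * Z ⟨p.src, p.ν⟩
              * star ((GaugeField.plaqHol W p : Matrix.specialUnitaryGroup (Fin N) ℂ) : Matrix (Fin N) (Fin N) ℂ)))
  -- `‖c‖ ≤ ‖K‖ + ‖c − K‖`, and `‖c − K‖ = ‖K − c‖`
  have hKc' : ‖curl (torusT P i) (fun κ z => unitsField (toUField W) ⟨z, κ⟩) (fun κ z => Z ⟨z, κ⟩) p.μ p.ν p.src
        - (Z ⟨p.src, p.μ⟩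
          + ((W ⟨p.src, p.μ⟩ : Matrix (Fin N) (Fin N) ℂ) * Z ⟨p.src.shift p.μ, p.ν⟩ * star (W ⟨p.src, p.μ⟩ : Matrix (Fin N) (Fin N) ℂ))
          - (((W ⟨p.src, p.μ⟩ * W ⟨p.src.shift p.μ, p.ν⟩ * (W ⟨p.src.shift p.ν, p.μ⟩)⁻¹ : Matrix.specialUnitaryGroup (Fin N) ℂ) : Matrix (Fin N) (Fin N) ℂ)
              * Z ⟨p.src.shift p.ν, p.μ⟩
              * star ((W ⟨p.src, p.μ⟩ * W ⟨p.src.shift p.μ, p.ν⟩ * (W ⟨p.src.shift p.ν, p.μ⟩)⁻¹ : Matrix.specialUnitaryGroup (Fin N) ℂ) : Matrix (Fin N) (Fin N) ℂ))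
          - (((GaugeField.plaqHol W p : Matrix.specialUnitaryGroup (Fin N) ℂ) : Matrix (Fin N) (Fin N) ℂ) * Z ⟨p.src, p.ν⟩
              * star ((GaugeField.plaqHol W p : Matrix.specialUnitaryGroup (Fin N) ℂ) : Matrix (Fin N) (Fin N) ℂ)))‖
      ≤ 2 * a * (‖Z ⟨p.src.shift p.ν, p.μ⟩‖ + ‖Z ⟨p.src, p.ν⟩‖) := by
    rw [norm_sub_rev]; exact hKc
  linarith

/-! ## §2 The energies -/

omit [NeZero N] in
/-- Re-indexing: the `(site, μ<ν)` sum is the plaquette sum. [folklore] [cite: Balaban1985Averaging, (5) p.18] -/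
theorem sum_ite_eq_sum_plaq (f : Site P i → Fin P.d → Fin P.d → ℝ) :
    ∑ x : Site P i, ∑ μ : Fin P.d, ∑ ν : Fin P.d, (if μ < ν then f x μ ν else 0) = ∑ p : Plaq P i, f p.src p.μ p.ν := by
  classical
  have hinj : Function.Injective (fun p : Plaq P i => (p.src, p.μ, p.ν)) := by
    rintro ⟨x, μ, ν, h⟩ ⟨x', μ', ν', h'⟩ hpq
    simp only [Prod.mk.injEq] at hpq
    obtain ⟨h1, h2, h3⟩ := hpq
    subst h1; subst h2; subst h3
    rfl
  have himg : (Finset.univ : Finset (Plaq P i)).image (fun p => (p.src, p.μ, p.ν))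
      = Finset.univ.filter (fun t : Site P i × Fin P.d × Fin P.d => t.2.1 < t.2.2) := by
    ext t
    simp only [Finset.mem_image, Finset.mem_univ, true_and, Finset.mem_filter]
    constructor
    · rintro ⟨p, rfl⟩
      exact p.hμν
    · intro ht
      exact ⟨⟨t.1, t.2.1, t.2.2, ht⟩, rfl⟩
  symm
  calc ∑ p : Plaq P i, f p.src p.μ p.ν
      = ∑ t ∈ (Finset.univ : Finset (Plaq P i)).image (fun p => (p.src, p.μ, p.ν)), f t.1 t.2.1 t.2.2 := by
        rw [Finset.sum_image fun p _ q _ h => hinj h]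
    _ = ∑ t ∈ Finset.univ.filter (fun t : Site P i × Fin P.d × Fin P.d => t.2.1 < t.2.2), f t.1 t.2.1 t.2.2 := by rw [himg]
    _ = ∑ t : Site P i × Fin P.d × Fin P.d, if t.2.1 < t.2.2 then f t.1 t.2.1 t.2.2 else 0 := Finset.sum_filter _ _
    _ = ∑ x : Site P i, ∑ μ : Fin P.d, ∑ ν : Fin P.d, if μ < ν then f x μ ν else 0 := by
        rw [Fintype.sum_prod_type]
        exact Finset.sum_congr rfl fun x _ => by rw [Fintype.sum_prod_type]

/-- ★★★ **THE B9 CURL ENERGY AGAINST THE DOOR'S PLAQUETTE ENERGY.**  For an `SU(N)` background `W` with `dist1(W(∂p)) ≤ a` and any bond field `D`: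
`CURL_HS(i·D) ≤ N·(2·K_W(i·D) + 32·d·a²·Σ_b‖D_b‖²)`, where `CURL_HS` is the Hilbert–Schmidt curl energy of the `B9Eq39Adjoint` calculus
(`Σ_x Σ_{μ<ν} Σ_{jk} |curl_{μν}(x)_{jk}|²`, the letter of ✓ `sum_normSq_covGrad_le_curl_divB`) and `K_W` the door's plaquette form (the letter of
✓ `Prop7SliceOfCorrectorRows`). [cite: Balaban1985Variational, (47)-(48) pp.285-286, (135) p.298] [cite: Balaban1985BackgroundPropagators, (3.4) p.391] -/
theorem curlHS_le_plaqK (W : GaugeField P i (Matrix.specialUnitaryGroup (Fin N) ℂ)) {a : ℝ}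
    (hU : ∀ p : Plaq P i, dist1 (GaugeField.plaqHol W p) ≤ a) (D : PBond P i → Matrix (Fin N) (Fin N) ℂ) :
    (∑ x : Site P i, ∑ μ : Fin P.d, ∑ ν : Fin P.d,
        (if μ < ν then ∑ j : Fin N, ∑ k : Fin N,
          ‖(curl (torusT P i) (fun κ z => unitsField (toUField W) ⟨z, κ⟩) (fun κ z => Complex.I • D ⟨z, κ⟩) μ ν x) j k‖ ^ 2 else 0))
      ≤ N * (2 * (∑ p : Plaq P i, ‖((Complex.I • D ⟨p.src, p.μ⟩)
          + ((W ⟨p.src, p.μ⟩ : Matrix (Fin N) (Fin N) ℂ) * (Complex.I • D ⟨p.src.shift p.μ, p.ν⟩) * star (W ⟨p.src, p.μ⟩ : Matrix (Fin N) (Fin N) ℂ))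
          - (((W ⟨p.src, p.μ⟩ * W ⟨p.src.shift p.μ, p.ν⟩ * (W ⟨p.src.shift p.ν, p.μ⟩)⁻¹ : Matrix.specialUnitaryGroup (Fin N) ℂ) : Matrix (Fin N) (Fin N) ℂ)
              * (Complex.I • D ⟨p.src.shift p.ν, p.μ⟩)
              * star ((W ⟨p.src, p.μ⟩ * W ⟨p.src.shift p.μ, p.ν⟩ * (W ⟨p.src.shift p.ν, p.μ⟩)⁻¹ : Matrix.specialUnitaryGroup (Fin N) ℂ) : Matrix (Fin N) (Fin N) ℂ))
          - (((GaugeField.plaqHol W p : Matrix.specialUnitaryGroup (Fin N) ℂ) : Matrix (Fin N) (Fin N) ℂ) * (Complex.I • D ⟨p.src, p.ν⟩)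
              * star ((GaugeField.plaqHol W p : Matrix.specialUnitaryGroup (Fin N) ℂ) : Matrix (Fin N) (Fin N) ℂ)))‖ ^ 2)
        + 32 * P.d * a ^ 2 * ∑ b : PBond P i, ‖D b‖ ^ 2) := by
  have hI : ∀ b, ‖Complex.I • D b‖ = ‖D b‖ := fun b => by rw [norm_smul, Complex.norm_I, one_mul]
  -- HS ≤ N·op under the `if`, then re-index to plaquettes
  have h1 : (∑ x : Site P i, ∑ μ : Fin P.d, ∑ ν : Fin P.d,
        (if μ < ν then ∑ j : Fin N, ∑ k : Fin N,
          ‖(curl (torusT P i) (fun κ z => unitsField (toUField W) ⟨z, κ⟩) (fun κ z => Complex.I • D ⟨z, κ⟩) μ ν x) j k‖ ^ 2 else 0))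
      ≤ ∑ x : Site P i, ∑ μ : Fin P.d, ∑ ν : Fin P.d,
        (if μ < ν then N * ‖curl (torusT P i) (fun κ z => unitsField (toUField W) ⟨z, κ⟩) (fun κ z => Complex.I • D ⟨z, κ⟩) μ ν x‖ ^ 2 else 0) := by
    refine Finset.sum_le_sum fun x _ => Finset.sum_le_sum fun μ _ => Finset.sum_le_sum fun ν _ => ?_
    split_ifs
    · exact sum_norm_sq_le_mul_opNorm_sq _
    · exact le_rfl
  refine h1.trans ?_
  rw [sum_ite_eq_sum_plaq (fun x μ ν => N * ‖curl (torusT P i) (fun κ z => unitsField (toUField W) ⟨z, κ⟩) (fun κ z => Complex.I • D ⟨z, κ⟩) μ ν x‖ ^ 2)]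
  -- pointwise on each plaquette
  have hpt : ∀ p : Plaq P i, ‖curl (torusT P i) (fun κ z => unitsField (toUField W) ⟨z, κ⟩) (fun κ z => Complex.I • D ⟨z, κ⟩) p.μ p.ν p.src‖ ^ 2
      ≤ 2 * ‖((Complex.I • D ⟨p.src, p.μ⟩)
          + ((W ⟨p.src, p.μ⟩ : Matrix (Fin N) (Fin N) ℂ) * (Complex.I • D ⟨p.src.shift p.μ, p.ν⟩) * star (W ⟨p.src, p.μ⟩ : Matrix (Fin N) (Fin N) ℂ))
          - (((W ⟨p.src, p.μ⟩ * W ⟨p.src.shift p.μ, p.ν⟩ * (W ⟨p.src.shift p.ν, p.μ⟩)⁻¹ : Matrix.specialUnitaryGroup (Fin N) ℂ) : Matrix (Fin N) (Fin N) ℂ)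
              * (Complex.I • D ⟨p.src.shift p.ν, p.μ⟩)
              * star ((W ⟨p.src, p.μ⟩ * W ⟨p.src.shift p.μ, p.ν⟩ * (W ⟨p.src.shift p.ν, p.μ⟩)⁻¹ : Matrix.specialUnitaryGroup (Fin N) ℂ) : Matrix (Fin N) (Fin N) ℂ))
          - (((GaugeField.plaqHol W p : Matrix.specialUnitaryGroup (Fin N) ℂ) : Matrix (Fin N) (Fin N) ℂ) * (Complex.I • D ⟨p.src, p.ν⟩)
              * star ((GaugeField.plaqHol W p : Matrix.specialUnitaryGroup (Fin N) ℂ) : Matrix (Fin N) (Fin N) ℂ)))‖ ^ 2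
        + 16 * a ^ 2 * (‖D ⟨p.src.shift p.ν, p.μ⟩‖ ^ 2 + ‖D ⟨p.src, p.ν⟩‖ ^ 2) := by
    intro p
    have h := norm_curl_le_plaqTerm_add W hU (fun b => Complex.I • D b) p
    rw [hI, hI] at h
    have h0 : 0 ≤ ‖curl (torusT P i) (fun κ z => unitsField (toUField W) ⟨z, κ⟩) (fun κ z => Complex.I • D ⟨z, κ⟩) p.μ p.ν p.src‖ := norm_nonneg _
    have hsq := pow_le_pow_left₀ h0 h 2
    have ha : ‖((GaugeField.plaqHol W p : Matrix.specialUnitaryGroup (Fin N) ℂ) : Matrix (Fin N) (Fin N) ℂ) - 1‖ ≤ a := hU p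
    have ha0 : 0 ≤ a := (norm_nonneg _).trans ha
    nlinarith [sq_nonneg (‖((Complex.I • D ⟨p.src, p.μ⟩)
          + ((W ⟨p.src, p.μ⟩ : Matrix (Fin N) (Fin N) ℂ) * (Complex.I • D ⟨p.src.shift p.μ, p.ν⟩) * star (W ⟨p.src, p.μ⟩ : Matrix (Fin N) (Fin N) ℂ))
          - (((W ⟨p.src, p.μ⟩ * W ⟨p.src.shift p.μ, p.ν⟩ * (W ⟨p.src.shift p.ν, p.μ⟩)⁻¹ : Matrix.specialUnitaryGroup (Fin N) ℂ) : Matrix (Fin N) (Fin N) ℂ)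
              * (Complex.I • D ⟨p.src.shift p.ν, p.μ⟩)
              * star ((W ⟨p.src, p.μ⟩ * W ⟨p.src.shift p.μ, p.ν⟩ * (W ⟨p.src.shift p.ν, p.μ⟩)⁻¹ : Matrix.specialUnitaryGroup (Fin N) ℂ) : Matrix (Fin N) (Fin N) ℂ))
          - (((GaugeField.plaqHol W p : Matrix.specialUnitaryGroup (Fin N) ℂ) : Matrix (Fin N) (Fin N) ℂ) * (Complex.I • D ⟨p.src, p.ν⟩)
              * star ((GaugeField.plaqHol W p : Matrix.specialUnitaryGroup (Fin N) ℂ) : Matrix (Fin N) (Fin N) ℂ)))‖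
        - 2 * a * (‖D ⟨p.src.shift p.ν, p.μ⟩‖ + ‖D ⟨p.src, p.ν⟩‖)),
      sq_nonneg (‖D ⟨p.src.shift p.ν, p.μ⟩‖ - ‖D ⟨p.src, p.ν⟩‖), mul_nonneg ha0 (norm_nonneg (D ⟨p.src.shift p.ν, p.μ⟩)),
      mul_nonneg ha0 (norm_nonneg (D ⟨p.src, p.ν⟩))]
  have hN : (0 : ℝ) ≤ N := Nat.cast_nonneg N
  have h2 : ∑ p : Plaq P i, (N : ℝ) * ‖curl (torusT P i) (fun κ z => unitsField (toUField W) ⟨z, κ⟩) (fun κ z => Complex.I • D ⟨z, κ⟩) p.μ p.ν p.src‖ ^ 2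
      ≤ ∑ p : Plaq P i, (N : ℝ) * (2 * ‖((Complex.I • D ⟨p.src, p.μ⟩)
          + ((W ⟨p.src, p.μ⟩ : Matrix (Fin N) (Fin N) ℂ) * (Complex.I • D ⟨p.src.shift p.μ, p.ν⟩) * star (W ⟨p.src, p.μ⟩ : Matrix (Fin N) (Fin N) ℂ))
          - (((W ⟨p.src, p.μ⟩ * W ⟨p.src.shift p.μ, p.ν⟩ * (W ⟨p.src.shift p.ν, p.μ⟩)⁻¹ : Matrix.specialUnitaryGroup (Fin N) ℂ) : Matrix (Fin N) (Fin N) ℂ)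
              * (Complex.I • D ⟨p.src.shift p.ν, p.μ⟩)
              * star ((W ⟨p.src, p.μ⟩ * W ⟨p.src.shift p.μ, p.ν⟩ * (W ⟨p.src.shift p.ν, p.μ⟩)⁻¹ : Matrix.specialUnitaryGroup (Fin N) ℂ) : Matrix (Fin N) (Fin N) ℂ))
          - (((GaugeField.plaqHol W p : Matrix.specialUnitaryGroup (Fin N) ℂ) : Matrix (Fin N) (Fin N) ℂ) * (Complex.I • D ⟨p.src, p.ν⟩)
              * star ((GaugeField.plaqHol W p : Matrix.specialUnitaryGroup (Fin N) ℂ) : Matrix (Fin N) (Fin N) ℂ)))‖ ^ 2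
        + 16 * a ^ 2 * (‖D ⟨p.src.shift p.ν, p.μ⟩‖ ^ 2 + ‖D ⟨p.src, p.ν⟩‖ ^ 2)) :=
    Finset.sum_le_sum fun p _ => mul_le_mul_of_nonneg_left (hpt p) hN
  refine h2.trans ?_
  -- the two curvature slots against the bond mass
  have hslots : ∑ p : Plaq P i, (‖D ⟨p.src.shift p.ν, p.μ⟩‖ ^ 2 + ‖D ⟨p.src, p.ν⟩‖ ^ 2) ≤ 2 * P.d * ∑ b : PBond P i, ‖D b‖ ^ 2 := by
    have hle := sum_plaq_le_sum_site_dir (P := P) (i := i) (fun x μ ν => ‖D ⟨x.shift ν, μ⟩‖ ^ 2 + ‖D ⟨x, ν⟩‖ ^ 2) (fun x μ ν => by positivity)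
    refine hle.trans (le_of_eq ?_)
    obtain ⟨-, -, e3, e4⟩ := sum_site_dir_dir_shift_eq (P := P) (i := i) D
    simp only [Finset.sum_add_distrib]
    rw [e3, e4]; ring
  rw [← Finset.mul_sum, Finset.sum_add_distrib, ← Finset.mul_sum, ← Finset.mul_sum]
  have ha2 : (0 : ℝ) ≤ 16 * a ^ 2 := by positivity
  nlinarith [mul_le_mul_of_nonneg_left hslots ha2, hN, mul_nonneg hN (mul_nonneg ha2 (Finset.sum_nonneg fun p (_ : p ∈ (Finset.univ : Finset (Plaq P i))) =>
    add_nonneg (sq_nonneg ‖D ⟨p.src.shift p.ν, p.μ⟩‖) (sq_nonneg ‖D ⟨p.src, p.ν⟩‖)))]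

end Summit.QuantumFields.YangMills.Theorems.Prop7PlaquetteCurlComparison

end
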